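import Summits.QuantumAdvantage.QuantumAdvantage.Theorems.LinnikCubicClassGroupsDegreeOnePrimesEscapePermutationType
import Summits.QuantumAdvantage.QuantumAdvantage.Theorems.LinnikCubicClassGroupsDegreeOnePrimesEscapeConjClassShortIntervalDHCorollaries
import HarnessLib

/-!
# Every splitting type of every number field occurs in every SHORT interval `(x, x+h]`,
# `x ≥ |d_K|^L`, `x^{1−δ} ≤ h ≤ x`

Topic `Summits/QuantumAdvantage/QuantumAdvantage/Theorems`, cell B2b-1 (linnik-cubic), PART A (gen 17); helper
toward the crux `DegreeOnePrimesEscape` (stmt-QuantumAdvantage-11543) of route `LinnikCubicClassGroups`.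
HONEST FRAMING: the value of this file is a THEOREM (kernel-checked, GRH-free, Siegel-free, unconditional) — NOT
summit progress.

For a number field `K` of degree `n` with Galois-closure data `(N, f, ψ)` (`N ⊇ f(K)` Galois, `[N:ℚ] ≤ n!`,
`|d_N| ≤ |d_K|^{[N:ℚ]}`, `ψ : Gal(N/ℚ) → S_n` with `Gal(N/fK) = Stab(0)`; such data exist for every `K`,
`exists_galoisClosure_perm`) the splitting types of the unramified primes of `K` are the full cycle types of
the `ψ σ` (Dedekind's dictionary `splittingType_eq_fullCycleType_of_hom`).  From the Deuring–Heilbronn-sharp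
short-interval Chebotarev theorem (`exists_prime_frobenius_mem_shortInterval_all`: a prime with EVERY prescribed
Frobenius class in every short interval of the Linnik range, no exceptional-character proviso):

* `exists_prime_splittingType_mem_shortInterval` — for `n > 1` there are `δ, L > 0` such that for every such
  `K, N, f, ψ`, every `σ ∈ Gal(N/ℚ)`, every `x ≥ |d_K|^L` and every `h` with `x^{1−δ} ≤ h ≤ x` there is a
  prime `p ∈ (x, x+h]`, `p ∤ d_K`, whose splitting type in `K` is the full cycle type of `ψ σ`.
  (Hoheisel–Linnik–Chebotarev for splitting types; the interval version `(x, 2x]` is the gen-14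
  `exists_prime_splittingType_mem_Ioc`.)
References: [LagariasMontgomeryOdlyzko1979, Thm. 1.1]; A. Balog, K. Ono, J. Number Theory 91 (2001);
S. Gun, S. L. Naik, arXiv:2405.04698 (2024), Thm. 7; [Perlis1977, §1].
-/

noncomputable section

open scoped NumberField nonZeroDivisors
open Finset Real Ideal NumberField
open Literature.NumberTheory.NumberFields Literature.NumberTheory.LFunctions
  Literature.NumberTheory.LFunctions.NumberField

namespace Summit.QuantumAdvantage.QuantumAdvantage.Theorems.DegreeOnePrimesEscape

set_option maxHeartbeats 1600000 in
/-- **Every splitting type in every short interval `(x, x+h]`, `x ≥ |d_K|^L`, `x^{1−δ} ≤ h ≤ x`, for every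
number field** (see the module docstring).  Unconditional. [cite: LagariasMontgomeryOdlyzko1979, Theorem 1.1]
[cite: Perlis1977, §1] -/
theorem exists_prime_splittingType_mem_shortInterval (n : ℕ) [NeZero n] (hn : 1 < n) :
    ∃ δ L : ℝ, 0 < δ ∧ δ ≤ 1 / 64 ∧ 0 < L ∧ ∀ (K : Type) [Field K] [NumberField K], Module.finrank ℚ K = n →
      ∀ (N : Type) [Field N] [NumberField N] [IsGalois ℚ N] (f : K →ₐ[ℚ] N),
        Module.finrank ℚ N ≤ n.factorial →
        (NumberField.discr N).natAbs ≤ (NumberField.discr K).natAbs ^ Module.finrank ℚ N →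
        ∀ ψ : (N ≃ₐ[ℚ] N) →* Equiv.Perm (Fin n),
          (∀ g : N ≃ₐ[ℚ] N, g ∈ f.fieldRange.fixingSubgroup ↔ ψ g 0 = 0) →
          ∀ σ : N ≃ₐ[ℚ] N, ∀ x h : ℝ, ((NumberField.discr K).natAbs : ℝ) ^ L ≤ x →
            x ^ (1 - δ) ≤ h → h ≤ x →
            ∃ p : ℕ, p.Prime ∧ x < p ∧ (p : ℝ) ≤ x + h ∧ ¬ ((p : ℤ) ∣ NumberField.discr K) ∧
              splittingType K p = (ψ σ).cycleType + Multiset.replicate (n - (ψ σ).support.card) 1 := by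
  classical
  -- one pair of constants for every possible degree `m ≤ n!` of `N`
  have hdeg : ∀ m : ℕ, ∃ δ L : ℝ, 0 < δ ∧ δ ≤ 1 / 64 ∧ 0 < L ∧ (1 < m → ∀ (N : Type) [Field N]
      [NumberField N] [IsGalois ℚ N], Module.finrank ℚ N = m → ∀ σ : N ≃ₐ[ℚ] N, ∀ x h : ℝ,
        ((NumberField.discr N).natAbs : ℝ) ^ L ≤ x → x ^ (1 - δ) ≤ h → h ≤ x →
        ∃ p : ℕ, p.Prime ∧ x < p ∧ (p : ℝ) ≤ x + h ∧ ¬ ((p : ℤ) ∣ NumberField.discr N) ∧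
          ∃ (Q : Ideal (𝓞 N)) (_ : Q.IsMaximal) (_ : Q.LiesOver (span {(p : ℤ)})) (φ g : N ≃ₐ[ℚ] N),
            IsArithFrobAt ℤ φ Q ∧ Q.inertia (N ≃ₐ[ℚ] N) = ⊥ ∧ g * φ * g⁻¹ = σ) := by
    intro m
    by_cases hm : 1 < m
    · obtain ⟨δ, L, hδ, hδ64, hL, h⟩ := exists_prime_frobenius_mem_shortInterval_all m hm
      exact ⟨δ, L, hδ, hδ64, hL, fun _ => h⟩
    · exact ⟨1 / 64, 1, by norm_num, le_rfl, one_pos, fun h => absurd h hm⟩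
  choose δf Lf hδf hδf64 hLf hthm using hdeg
  set R : Finset ℕ := Finset.range (n.factorial + 1) with hR
  have hRne : R.Nonempty := ⟨0, by rw [hR]; simp⟩
  set δ : ℝ := R.inf' hRne δf with hδ
  set L : ℝ := (n.factorial : ℝ) * ∑ m ∈ R, Lf m with hL
  have hsum1 : ∀ m ≤ n.factorial, Lf m ≤ ∑ m ∈ R, Lf m := fun m hm =>
    Finset.single_le_sum (f := Lf) (fun i _ => (hLf i).le) (Finset.mem_range.mpr (Nat.lt_succ_of_le hm))
  have hδle : ∀ m ≤ n.factorial, δ ≤ δf m := fun m hm =>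
    Finset.inf'_le δf (Finset.mem_range.mpr (Nat.lt_succ_of_le hm))
  have hfac1 : (1 : ℝ) ≤ n.factorial := by exact_mod_cast Nat.succ_le_of_lt (Nat.factorial_pos n)
  have hLpos : 0 < L := by
    have : 0 < ∑ m ∈ R, Lf m := lt_of_lt_of_le (hLf 0) (hsum1 0 (Nat.zero_le _))
    rw [hL]; positivity
  have hδpos : 0 < δ := by
    rw [hδ, Finset.lt_inf'_iff]; exact fun m _ => hδf m
  have hδ64 : δ ≤ 1 / 64 := (hδle 0 (Nat.zero_le _)).trans (hδf64 0)
  refine ⟨δ, L, hδpos, hδ64, hLpos, fun K _ _ hK N _ _ _ f hNle hdN ψ hstab σ x h hx hhx hhx' => ?_⟩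
  set m := Module.finrank ℚ N with hm
  have hKf : Module.finrank ℚ f.fieldRange = n := by
    rw [← hK]; exact (f.equivFieldRange.toLinearEquiv.finrank_eq).symm
  have hKN : n ≤ m := by
    rw [← hKf]
    have h2 := Module.finrank_mul_finrank ℚ f.fieldRange N
    have hpos : 0 < Module.finrank f.fieldRange N := Module.finrank_pos
    exact le_of_le_of_eq (Nat.le_mul_of_pos_right _ hpos) h2
  have hm1 : 1 < m := lt_of_lt_of_le hn hKN
  -- sizes: `|d_N|^{L(m)} ≤ |d_K|^{m L(m)} ≤ |d_K|^L ≤ x`, and `x^{1−δ(m)} ≤ x^{1−δ} ≤ h`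
  set d : ℝ := ((NumberField.discr K).natAbs : ℝ) with hd
  have hd3 : (3 : ℝ) ≤ d := three_le_natAbs_discr_real K (by rw [hK]; exact hn)
  have hd1 : (1 : ℝ) ≤ d := by linarith
  have hdNR : ((NumberField.discr N).natAbs : ℝ) ≤ d ^ (m : ℝ) := by
    rw [Real.rpow_natCast, hd]; exact_mod_cast hdN
  have hxN : ((NumberField.discr N).natAbs : ℝ) ^ Lf m ≤ x := by
    have h3 : (m : ℝ) * Lf m ≤ L := by
      rw [hL]
      have hmf : (m : ℝ) ≤ n.factorial := by exact_mod_cast hNle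
      exact mul_le_mul hmf (hsum1 m hNle) (hLf m).le (by positivity)
    calc ((NumberField.discr N).natAbs : ℝ) ^ Lf m ≤ (d ^ (m : ℝ)) ^ Lf m :=
          Real.rpow_le_rpow (Nat.cast_nonneg _) hdNR (hLf m).le
      _ = d ^ ((m : ℝ) * Lf m) := by rw [← Real.rpow_mul (by linarith)]
      _ ≤ d ^ L := Real.rpow_le_rpow_of_exponent_le hd1 h3
      _ ≤ x := hx
  have hx1 : (1 : ℝ) ≤ x := by
    have h1 : (1 : ℝ) ≤ d ^ L := Real.one_le_rpow hd1 hLpos.le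
    linarith
  have hhN : x ^ (1 - δf m) ≤ h := by
    have := hδle m hNle
    exact (Real.rpow_le_rpow_of_exponent_le hx1 (by linarith)).trans hhx
  obtain ⟨p, hp, hxp, hp2, hpN, Q, hQ, hQp, φ, g, hφ, hI, hg⟩ := hthm m hm1 N rfl σ x h hxN hhN hhx'
  -- `p ∤ d_K`, and the splitting type of `p` in `K` is the full cycle type of `ψ φ = ψ (g⁻¹ σ g)`
  have hdisc' : NumberField.discr f.fieldRange = NumberField.discr K :=
    (NumberField.discr_eq_discr_of_algEquiv K f.equivFieldRange).symm
  have hdvd : ¬ ((p : ℤ) ∣ NumberField.discr K) := fun h =>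
    hpN (h.trans (hdisc' ▸ NumberField.discr_dvd_discr f.fieldRange N))
  refine ⟨p, hp, hxp, hp2, hdvd, ?_⟩
  haveI := hQ
  haveI := hQp
  rw [ArithmeticallyEquivalent.of_algEquiv f.equivFieldRange p hp,
    splittingType_eq_fullCycleType_of_hom f.fieldRange ψ hstab hKf hp Q hφ hI, ← hg]
  exact (fullCycleType_conj ψ φ g).symm

/-- **Closure-free form**: for every number field `K` of degree `n > 1` there are Galois-closure data
`(N, f, ψ)` such that every full cycle type of `ψ(Gal(N/ℚ))` — i.e. every splitting type of an unramified
prime of `K` — is the splitting type of a prime `p ∤ d_K` in every `(x, x+h]`, `x ≥ |d_K|^L`,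
`x^{1−δ} ≤ h ≤ x` (constants depending on `n` only).  Unconditional. -/
theorem exists_prime_splittingType_mem_shortInterval_closure (n : ℕ) [NeZero n] (hn : 1 < n) :
    ∃ δ L : ℝ, 0 < δ ∧ δ ≤ 1 / 64 ∧ 0 < L ∧ ∀ (K : Type) [Field K] [NumberField K], Module.finrank ℚ K = n →
      ∃ (N : Type) (_ : Field N) (_ : NumberField N) (_ : IsGalois ℚ N) (f : K →ₐ[ℚ] N)
        (ψ : (N ≃ₐ[ℚ] N) →* Equiv.Perm (Fin n)),
        (∀ g : N ≃ₐ[ℚ] N, g ∈ f.fieldRange.fixingSubgroup ↔ ψ g 0 = 0) ∧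
        (∀ p : ℕ, p.Prime → ¬ ((p : ℤ) ∣ NumberField.discr N) → ∃ σ : N ≃ₐ[ℚ] N,
          splittingType K p = (ψ σ).cycleType + Multiset.replicate (n - (ψ σ).support.card) 1) ∧
        ∀ σ : N ≃ₐ[ℚ] N, ∀ x h : ℝ, ((NumberField.discr K).natAbs : ℝ) ^ L ≤ x →
          x ^ (1 - δ) ≤ h → h ≤ x →
          ∃ p : ℕ, p.Prime ∧ x < p ∧ (p : ℝ) ≤ x + h ∧ ¬ ((p : ℤ) ∣ NumberField.discr K) ∧
            splittingType K p = (ψ σ).cycleType + Multiset.replicate (n - (ψ σ).support.card) 1 := by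
  obtain ⟨δ, L, hδ, hδ64, hL, h⟩ := exists_prime_splittingType_mem_shortInterval n hn
  refine ⟨δ, L, hδ, hδ64, hL, fun K _ _ hK => ?_⟩
  obtain ⟨N, _, _, hGal, hNle, hdN, f, ψ, hstab⟩ := exists_galoisClosure_perm n K hK
  haveI := hGal
  have hKf : Module.finrank ℚ f.fieldRange = n := by
    rw [← hK]; exact (f.equivFieldRange.toLinearEquiv.finrank_eq).symm
  refine ⟨N, inferInstance, inferInstance, hGal, f, ψ, hstab, fun p hp hpN => ?_,
    fun σ x h' hx hhx hhx' => h K hK N f hNle hdN ψ hstab σ x h' hx hhx hhx'⟩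
  obtain ⟨Q, hQ, hQp, ⟨φ, hφ⟩, hI⟩ := exists_isArithFrobAt_of_not_dvd_discr (N := N) hp hpN
  haveI := hQ
  haveI := hQp
  refine ⟨φ, ?_⟩
  rw [ArithmeticallyEquivalent.of_algEquiv f.equivFieldRange p hp]
  exact splittingType_eq_fullCycleType_of_hom f.fieldRange ψ hstab hKf hp Q hφ hI

end Summit.QuantumAdvantage.QuantumAdvantage.Theorems.DegreeOnePrimesEscape

end
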